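import Mathlib
import Summits.Ventures.PercRepro2.SevenTypedDomCore
import Summits.Ventures.PercRepro2.SevenTypedDomTransfer
import Summits.Ventures.PercRepro2.SortedPairs7
import Summits.Ventures.PercRepro2.MonoTPos
import Summits.Ventures.PercRepro2.TypedResidualDegree
import Summits.Ventures.PercRepro2.TypedResidualCruxMarks
import Summits.Ventures.PercRepro2.TypedResidualSplit

/-!
# Seven typed edges, XII.D: the DOMAIN-RESTRICTED reduced class (blind cell PercRepro2, night-3 g9, 2026-08-25)

g8's bridge (`SevenTypedBridge.lean`) for the domain-restricted rung: the label-level guards of the reduced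
class as before, plus the transfers of the domain hypotheses — `labD7_markdeg` (marks `a₁, a₂, o, b` of typed
degree `≥ 1` give `markDegOK7`), `typedConfig_seven` (the typed configuration is the all-open point of the cube),
`exists_bad_of_not_mild` (an instance that is not mild has a badly crossed point of the cube,
`config_eq_chain`, in `SevenTypedDomTransfer.lean`) — and **`typedCount_sept_K3_nonneg_dom`** / **`typedCount_nonneg_of_dom_card_seven`**: row 2′TRI
on every reduced instance with seven typed edges whose marks `a₁, a₂, o, b` carry typed edges, whose roots are
connected in the typed graph and which is not mild (`z ≡ false`, marks distinct up to `b = a₃` / `o = b`), modulo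
the finite statement `allOk7 okQ7Dom = true`.
-/

namespace Summit.Ventures.PercRepro2

open UnionCluster

namespace CovForm

namespace TwoTyped

open OneTyped TypedRed

section Bridge7D

open Classical TypedRed

variable {V : Type*} {E : Type*} [DecidableEq V] [Fintype E] [DecidableEq E] {R : Type*} [Field R]
  [LinearOrder R] [IsStrictOrderedRing R]
variable (ends : E → Sym2 V) (o a₁ a₂ a₃ b : V) (ps : Fin 7 → V × V)

omit [DecidableEq V] [Fintype E] [DecidableEq E] in
/-- In the all-closed configuration, labels agree exactly when the points coincide. -/
lemma labD7_eq_iff (p q : ℕ) :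
    labD7 ends o a₁ a₂ a₃ b ps p = labD7 ends o a₁ a₂ a₃ b ps q ↔ pt o a₁ a₂ a₃ b (xsOf7 ps) p = pt o a₁ a₂ a₃ b (xsOf7 ps) q := by
  unfold labD7
  rw [lab_eq_iff, conn_allClosed_iff]

omit [DecidableEq V] [Fintype E] [DecidableEq E] in
/-- `a₁` carries the label `0`. -/
lemma labD7_zero : labD7 ends o a₁ a₂ a₃ b ps 0 = 0 := lab_zero ends o a₁ a₂ a₃ b (xsOf7 ps) _

omit [DecidableEq V] [Fintype E] [DecidableEq E] in
/-- A label is at most its index. -/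
lemma labD7_le (i : ℕ) : labD7 ends o a₁ a₂ a₃ b ps i ≤ i := lab_le ends o a₁ a₂ a₃ b (xsOf7 ps) _ i

omit [DecidableEq V] [Fintype E] [DecidableEq E] in
/-- Labels are idempotent. -/
lemma labD7_idem (i : ℕ) : labD7 ends o a₁ a₂ a₃ b ps (labD7 ends o a₁ a₂ a₃ b ps i) = labD7 ends o a₁ a₂ a₃ b ps i :=
  lab_idem ends o a₁ a₂ a₃ b (xsOf7 ps) _ i

omit [DecidableEq V] [Fintype E] [DecidableEq E] in
/-- **The labels of the marks**: `a₂ ↦ 1`, `o ↦ 2`, `b ↦ 3` or `2` (`o = b`), `a₃ ↦ 4` or `3`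
(`a₃ = b`). -/
lemma labD7_marks (hm : MarksDistinct o a₁ a₂ a₃ b) :
    labD7 ends o a₁ a₂ a₃ b ps 1 = 1 ∧ labD7 ends o a₁ a₂ a₃ b ps 2 = 2 ∧
      ((labD7 ends o a₁ a₂ a₃ b ps 3 = 3 ∧ labD7 ends o a₁ a₂ a₃ b ps 4 = 4) ∨ (labD7 ends o a₁ a₂ a₃ b ps 3 = 3 ∧ labD7 ends o a₁ a₂ a₃ b ps 4 = 3) ∨ (labD7 ends o a₁ a₂ a₃ b ps 3 = 2 ∧ labD7 ends o a₁ a₂ a₃ b ps 4 = 4)) := by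
  obtain ⟨⟨h12, h31, h32, ho1, ho2, hb1, hb2⟩, ho3⟩ := hm
  have e := labD7_eq_iff ends o a₁ a₂ a₃ b ps
  have z := labD7_zero ends o a₁ a₂ a₃ b ps
  have l1 := labD7_le ends o a₁ a₂ a₃ b ps 1
  have l2 := labD7_le ends o a₁ a₂ a₃ b ps 2
  have l3 := labD7_le ends o a₁ a₂ a₃ b ps 3
  have l4 := labD7_le ends o a₁ a₂ a₃ b ps 4
  have i4 := labD7_idem ends o a₁ a₂ a₃ b ps 4
  have p0 : pt o a₁ a₂ a₃ b (xsOf7 ps) 0 = a₁ := rfl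
  have p1 : pt o a₁ a₂ a₃ b (xsOf7 ps) 1 = a₂ := rfl
  have p2 : pt o a₁ a₂ a₃ b (xsOf7 ps) 2 = o := rfl
  have p3 : pt o a₁ a₂ a₃ b (xsOf7 ps) 3 = b := rfl
  have p4 : pt o a₁ a₂ a₃ b (xsOf7 ps) 4 = a₃ := rfl
  have f1 : labD7 ends o a₁ a₂ a₃ b ps 1 = 1 := by
    by_contra h
    have h0 : labD7 ends o a₁ a₂ a₃ b ps 1 = labD7 ends o a₁ a₂ a₃ b ps 0 := by omega
    rw [e, p1, p0] at h0
    exact h12 h0.symm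
  have f2 : labD7 ends o a₁ a₂ a₃ b ps 2 = 2 := by
    by_contra h
    rcases (show labD7 ends o a₁ a₂ a₃ b ps 2 = 0 ∨ labD7 ends o a₁ a₂ a₃ b ps 2 = 1 by omega) with h0 | h0
    · have := (e 2 0).mp (by rw [h0, z]); rw [p2, p0] at this; exact ho1 this
    · have := (e 2 1).mp (by rw [h0, f1]); rw [p2, p1] at this; exact ho2 this
  have f3 : labD7 ends o a₁ a₂ a₃ b ps 3 = 3 ∨ labD7 ends o a₁ a₂ a₃ b ps 3 = 2 := by
    by_contra h
    rcases (show labD7 ends o a₁ a₂ a₃ b ps 3 = 0 ∨ labD7 ends o a₁ a₂ a₃ b ps 3 = 1 by omega) with h0 | h0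
    · have := (e 3 0).mp (by rw [h0, z]); rw [p3, p0] at this; exact hb1 this
    · have := (e 3 1).mp (by rw [h0, f1]); rw [p3, p1] at this; exact hb2 this
  have f4 : labD7 ends o a₁ a₂ a₃ b ps 4 = 4 ∨ labD7 ends o a₁ a₂ a₃ b ps 4 = 3 := by
    by_contra h
    rcases (show labD7 ends o a₁ a₂ a₃ b ps 4 = 0 ∨ labD7 ends o a₁ a₂ a₃ b ps 4 = 1 ∨ labD7 ends o a₁ a₂ a₃ b ps 4 = 2 by omega) with h0 | h0 | h0
    · have := (e 4 0).mp (by rw [h0, z]); rw [p4, p0] at this; exact h31 this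
    · have := (e 4 1).mp (by rw [h0, f1]); rw [p4, p1] at this; exact h32 this
    · have := (e 4 2).mp (by rw [h0, f2]); rw [p4, p2] at this; exact ho3 this.symm
  refine ⟨f1, f2, ?_⟩
  rcases f3 with h3 | h3 <;> rcases f4 with h4 | h4
  · exact Or.inl ⟨h3, h4⟩
  · exact Or.inr (Or.inl ⟨h3, h4⟩)
  · exact Or.inr (Or.inr ⟨h3, h4⟩)
  · exfalso
    rw [h4, h3] at i4
    omega

omit [DecidableEq V] [Fintype E] [DecidableEq E] in
/-- No typed loop: the two ends of a typed edge carry different labels. -/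
lemma labD7_loop {F : Finset E} (hred : Reduced ends o a₁ a₂ a₃ b F) {e : E} (he : e ∈ F)
    {x y : V} (hends : ends e = s(x, y)) {u w : ℕ} (hu : pt o a₁ a₂ a₃ b (xsOf7 ps) u = x)
    (hw : pt o a₁ a₂ a₃ b (xsOf7 ps) w = y) :
    labD7 ends o a₁ a₂ a₃ b ps u ≠ labD7 ends o a₁ a₂ a₃ b ps w := by
  intro h
  rw [labD7_eq_iff, hu, hw] at h
  exact hred.no_loop e he (by rw [hends, h]; exact Sym2.mk_isDiag_iff.mpr rfl)

omit [DecidableEq V] [Fintype E] [DecidableEq E] in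
/-- No parallel typed pair: two typed edges do not carry the same ordered label pair. -/
lemma labD7_par {F : Finset E} (hred : Reduced ends o a₁ a₂ a₃ b F) {e e' : E} (he : e ∈ F)
    (he' : e' ∈ F) (hne : e ≠ e') {x y x' y' : V} (hends : ends e = s(x, y))
    (hends' : ends e' = s(x', y')) {u w u' w' : ℕ} (hu : pt o a₁ a₂ a₃ b (xsOf7 ps) u = x)
    (hw : pt o a₁ a₂ a₃ b (xsOf7 ps) w = y) (hu' : pt o a₁ a₂ a₃ b (xsOf7 ps) u' = x') (hw' : pt o a₁ a₂ a₃ b (xsOf7 ps) w' = y') :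
    labD7 ends o a₁ a₂ a₃ b ps u = labD7 ends o a₁ a₂ a₃ b ps u' → labD7 ends o a₁ a₂ a₃ b ps w ≠ labD7 ends o a₁ a₂ a₃ b ps w' := by
  intro h1 h2
  rw [labD7_eq_iff, hu, hu'] at h1
  rw [labD7_eq_iff, hw, hw'] at h2
  exact hred.no_parallel e he e' he' hne (by rw [hends, hends', h1, h2])

omit [DecidableEq V] [Fintype E] [DecidableEq E] in
/-- No typed root pair: no typed edge carries the labels `(0, 1)`. -/
lemma labD7_root (hm : MarksDistinct o a₁ a₂ a₃ b) {F : Finset E} (hred : Reduced ends o a₁ a₂ a₃ b F)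
    {e : E} (he : e ∈ F) {x y : V} (hends : ends e = s(x, y)) {u w : ℕ}
    (hu : pt o a₁ a₂ a₃ b (xsOf7 ps) u = x) (hw : pt o a₁ a₂ a₃ b (xsOf7 ps) w = y) :
    ¬ (labD7 ends o a₁ a₂ a₃ b ps u = 0 ∧ labD7 ends o a₁ a₂ a₃ b ps w = 1) := by
  rintro ⟨h0, h1⟩
  have e0 : labD7 ends o a₁ a₂ a₃ b ps u = labD7 ends o a₁ a₂ a₃ b ps 0 := by
    rw [h0, labD7_zero]
  have e1 : labD7 ends o a₁ a₂ a₃ b ps w = labD7 ends o a₁ a₂ a₃ b ps 1 := by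
    rw [h1, (labD7_marks ends o a₁ a₂ a₃ b ps hm).1]
  rw [labD7_eq_iff, hu] at e0
  rw [labD7_eq_iff, hw] at e1
  exact hred.no_root_pair e he (by rw [hends, e0, e1]; rfl)

omit [Fintype E] in
/-- The typed degree over seven distinct typed edges, as seven indicators. -/
lemma typedDeg_seven (e1 e2 e3 e4 e5 e6 e7 : E) (h12 : e1 ≠ e2) (h13 : e1 ≠ e3) (h14 : e1 ≠ e4) (h15 : e1 ≠ e5) (h16 : e1 ≠ e6) (h17 : e1 ≠ e7) (h23 : e2 ≠ e3) (h24 : e2 ≠ e4) (h25 : e2 ≠ e5) (h26 : e2 ≠ e6) (h27 : e2 ≠ e7) (h34 : e3 ≠ e4) (h35 : e3 ≠ e5) (h36 : e3 ≠ e6) (h37 : e3 ≠ e7) (h45 : e4 ≠ e5) (h46 : e4 ≠ e6) (h47 : e4 ≠ e7) (h56 : e5 ≠ e6) (h57 : e5 ≠ e7) (h67 : e6 ≠ e7) (v : V) :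
    typedDeg ends {e1, e2, e3, e4, e5, e6, e7} v =
      (if v ∈ ends e1 then 1 else 0) + (if v ∈ ends e2 then 1 else 0) + (if v ∈ ends e3 then 1 else 0) +
        (if v ∈ ends e4 then 1 else 0) + (if v ∈ ends e5 then 1 else 0) + (if v ∈ ends e6 then 1 else 0) +
        (if v ∈ ends e7 then 1 else 0) := by
  unfold typedDeg
  rw [Finset.card_filter, Finset.sum_insert (by simp [h12, h13, h14, h15, h16, h17]), Finset.sum_insert (by simp [h23, h24, h25, h26, h27]), Finset.sum_insert (by simp [h34, h35, h36, h37]), Finset.sum_insert (by simp [h45, h46, h47]), Finset.sum_insert (by simp [h56, h57]), Finset.sum_insert (by simp [h67]), Finset.sum_singleton]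
  ring

omit [Fintype E] in
/-- **The edge-degree of a label is the typed degree of its vertex.** -/
lemma edeg7_eq (e1 e2 e3 e4 e5 e6 e7 : E) (h12 : e1 ≠ e2) (h13 : e1 ≠ e3) (h14 : e1 ≠ e4) (h15 : e1 ≠ e5) (h16 : e1 ≠ e6) (h17 : e1 ≠ e7) (h23 : e2 ≠ e3) (h24 : e2 ≠ e4) (h25 : e2 ≠ e5) (h26 : e2 ≠ e6) (h27 : e2 ≠ e7) (h34 : e3 ≠ e4) (h35 : e3 ≠ e5) (h36 : e3 ≠ e6) (h37 : e3 ≠ e7) (h45 : e4 ≠ e5) (h46 : e4 ≠ e6) (h47 : e4 ≠ e7) (h56 : e5 ≠ e6) (h57 : e5 ≠ e7) (h67 : e6 ≠ e7) (hends1 : ends e1 = s((ps 0).1, (ps 0).2)) (hends2 : ends e2 = s((ps 1).1, (ps 1).2)) (hends3 : ends e3 = s((ps 2).1, (ps 2).2)) (hends4 : ends e4 = s((ps 3).1, (ps 3).2)) (hends5 : ends e5 = s((ps 4).1, (ps 4).2)) (hends6 : ends e6 = s((ps 5).1, (ps 5).2)) (hends7 : ends e7 = s((ps 6).1, (ps 6).2))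 (p : ℕ) :
    edeg7 (labD7 ends o a₁ a₂ a₃ b ps p) (labD7 ends o a₁ a₂ a₃ b ps 5) (labD7 ends o a₁ a₂ a₃ b ps 6) (labD7 ends o a₁ a₂ a₃ b ps 7) (labD7 ends o a₁ a₂ a₃ b ps 8) (labD7 ends o a₁ a₂ a₃ b ps 9) (labD7 ends o a₁ a₂ a₃ b ps 10) (labD7 ends o a₁ a₂ a₃ b ps 11) (labD7 ends o a₁ a₂ a₃ b ps 12) (labD7 ends o a₁ a₂ a₃ b ps 13) (labD7 ends o a₁ a₂ a₃ b ps 14) (labD7 ends o a₁ a₂ a₃ b ps 15) (labD7 ends o a₁ a₂ a₃ b ps 16) (labD7 ends o a₁ a₂ a₃ b ps 17) (labD7 ends o a₁ a₂ a₃ b ps 18) = typedDeg ends {e1, e2, e3, e4, e5, e6, e7} (pt o a₁ a₂ a₃ b (xsOf7 ps) p) := by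
  rw [typedDeg_seven ends e1 e2 e3 e4 e5 e6 e7 h12 h13 h14 h15 h16 h17 h23 h24 h25 h26 h27 h34 h35 h36 h37 h45 h46 h47 h56 h57 h67]
  unfold edeg7
  simp only [hends1, hends2, hends3, hends4, hends5, hends6, hends7, Sym2.mem_iff, ← pt_xsOf7_5 o a₁ a₂ a₃ b ps, ← pt_xsOf7_6 o a₁ a₂ a₃ b ps, ← pt_xsOf7_7 o a₁ a₂ a₃ b ps, ← pt_xsOf7_8 o a₁ a₂ a₃ b ps, ← pt_xsOf7_9 o a₁ a₂ a₃ b ps, ← pt_xsOf7_10 o a₁ a₂ a₃ b ps, ← pt_xsOf7_11 o a₁ a₂ a₃ b ps, ← pt_xsOf7_12 o a₁ a₂ a₃ b ps, ← pt_xsOf7_13 o a₁ a₂ a₃ b ps, ← pt_xsOf7_14 o a₁ a₂ a₃ b ps, ← pt_xsOf7_15 o a₁ a₂ a₃ b ps, ← pt_xsOf7_16 o a₁ a₂ a₃ b ps, ← pt_xsOf7_17 o a₁ a₂ a₃ b ps, ← pt_xsOf7_18 o a₁ a₂ a₃ b ps,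
    ← labD7_eq_iff ends o a₁ a₂ a₃ b ps]
  simp only [eq_comm]

omit [Fintype E] [DecidableEq E] in
/-- A nonzero typed degree gives a typed edge at the vertex. -/
lemma exists_edge_of_typedDeg_ne_zero7 {F : Finset E} {v : V} (h : typedDeg ends F v ≠ 0) :
    ∃ f ∈ F, v ∈ ends f := by
  unfold typedDeg at h
  obtain ⟨f, hf⟩ := Finset.card_ne_zero.mp h
  rw [Finset.mem_filter] at hf
  exact ⟨f, hf.1, hf.2⟩

omit [Fintype E] in
/-- **The leaf guard holds on a reduced instance**: unmarked labels have typed degree `≥ 3`; `o`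
(when `o ≠ b`) and `b` (when distinct from `o`, `a₃`) are not typed leaves. -/
lemma labD7_deg (hm : MarksDistinct o a₁ a₂ a₃ b) (e1 e2 e3 e4 e5 e6 e7 : E)
    (hred : Reduced ends o a₁ a₂ a₃ b {e1, e2, e3, e4, e5, e6, e7}) (h12 : e1 ≠ e2) (h13 : e1 ≠ e3) (h14 : e1 ≠ e4) (h15 : e1 ≠ e5) (h16 : e1 ≠ e6) (h17 : e1 ≠ e7) (h23 : e2 ≠ e3) (h24 : e2 ≠ e4) (h25 : e2 ≠ e5) (h26 : e2 ≠ e6) (h27 : e2 ≠ e7) (h34 : e3 ≠ e4) (h35 : e3 ≠ e5) (h36 : e3 ≠ e6) (h37 : e3 ≠ e7) (h45 : e4 ≠ e5) (h46 : e4 ≠ e6) (h47 : e4 ≠ e7) (h56 : e5 ≠ e6) (h57 : e5 ≠ e7) (h67 : e6 ≠ e7) (hends1 : ends e1 = s((ps 0).1, (ps 0).2)) (hends2 : ends e2 = s((ps 1).1, (ps 1).2)) (hends3 : ends e3 = s((ps 2).1, (ps 2).2)) (hends4 : ends e4 = s((ps 3).1, (ps 3).2)) (hends5 : ends e5 = s((ps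 4).1, (ps 4).2)) (hends6 : ends e6 = s((ps 5).1, (ps 5).2)) (hends7 : ends e7 = s((ps 6).1, (ps 6).2)) :
    degOK7 (labD7 ends o a₁ a₂ a₃ b ps 3) (labD7 ends o a₁ a₂ a₃ b ps 4) (labD7 ends o a₁ a₂ a₃ b ps 5) (labD7 ends o a₁ a₂ a₃ b ps 6) (labD7 ends o a₁ a₂ a₃ b ps 7) (labD7 ends o a₁ a₂ a₃ b ps 8) (labD7 ends o a₁ a₂ a₃ b ps 9) (labD7 ends o a₁ a₂ a₃ b ps 10) (labD7 ends o a₁ a₂ a₃ b ps 11) (labD7 ends o a₁ a₂ a₃ b ps 12) (labD7 ends o a₁ a₂ a₃ b ps 13) (labD7 ends o a₁ a₂ a₃ b ps 14) (labD7 ends o a₁ a₂ a₃ b ps 15) (labD7 ends o a₁ a₂ a₃ b ps 16) (labD7 ends o a₁ a₂ a₃ b ps 17) (labD7 ends o a₁ a₂ a₃ b ps 18) = true := by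
  have hdeg := edeg7_eq ends o a₁ a₂ a₃ b ps e1 e2 e3 e4 e5 e6 e7 h12 h13 h14 h15 h16 h17 h23 h24 h25 h26 h27 h34 h35 h36 h37 h45 h46 h47 h56 h57 h67 hends1 hends2 hends3 hends4 hends5 hends6 hends7
  have hmk := labD7_marks ends o a₁ a₂ a₃ b ps hm
  have hle := labD7_le ends o a₁ a₂ a₃ b ps
  have heq := labD7_eq_iff ends o a₁ a₂ a₃ b ps
  obtain ⟨⟨h12', h31, h32, ho1, ho2, hb1, hb2⟩, ho3⟩ := hm
  have hmem : ∀ p, 5 ≤ p → p ≤ 18 → ∃ f ∈ ({e1, e2, e3, e4, e5, e6, e7} : Finset E), pt o a₁ a₂ a₃ b (xsOf7 ps) p ∈ ends f := by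
    intro p hp5 hp
    interval_cases p
    · exact ⟨e1, by simp, by rw [hends1]; exact Sym2.mem_mk_left _ _⟩
    · exact ⟨e1, by simp, by rw [hends1]; exact Sym2.mem_mk_right _ _⟩
    · exact ⟨e2, by simp, by rw [hends2]; exact Sym2.mem_mk_left _ _⟩
    · exact ⟨e2, by simp, by rw [hends2]; exact Sym2.mem_mk_right _ _⟩
    · exact ⟨e3, by simp, by rw [hends3]; exact Sym2.mem_mk_left _ _⟩
    · exact ⟨e3, by simp, by rw [hends3]; exact Sym2.mem_mk_right _ _⟩
    · exact ⟨e4, by simp, by rw [hends4]; exact Sym2.mem_mk_left _ _⟩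
    · exact ⟨e4, by simp, by rw [hends4]; exact Sym2.mem_mk_right _ _⟩
    · exact ⟨e5, by simp, by rw [hends5]; exact Sym2.mem_mk_left _ _⟩
    · exact ⟨e5, by simp, by rw [hends5]; exact Sym2.mem_mk_right _ _⟩
    · exact ⟨e6, by simp, by rw [hends6]; exact Sym2.mem_mk_left _ _⟩
    · exact ⟨e6, by simp, by rw [hends6]; exact Sym2.mem_mk_right _ _⟩
    · exact ⟨e7, by simp, by rw [hends7]; exact Sym2.mem_mk_left _ _⟩
    · exact ⟨e7, by simp, by rw [hends7]; exact Sym2.mem_mk_right _ _⟩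
  have hunm : ∀ p, 5 ≤ p → p ≤ 18 → labD7 ends o a₁ a₂ a₃ b ps p < 5 ∨ 3 ≤ edeg7 (labD7 ends o a₁ a₂ a₃ b ps p) (labD7 ends o a₁ a₂ a₃ b ps 5) (labD7 ends o a₁ a₂ a₃ b ps 6) (labD7 ends o a₁ a₂ a₃ b ps 7) (labD7 ends o a₁ a₂ a₃ b ps 8) (labD7 ends o a₁ a₂ a₃ b ps 9) (labD7 ends o a₁ a₂ a₃ b ps 10) (labD7 ends o a₁ a₂ a₃ b ps 11) (labD7 ends o a₁ a₂ a₃ b ps 12) (labD7 ends o a₁ a₂ a₃ b ps 13) (labD7 ends o a₁ a₂ a₃ b ps 14) (labD7 ends o a₁ a₂ a₃ b ps 15) (labD7 ends o a₁ a₂ a₃ b ps 16) (labD7 ends o a₁ a₂ a₃ b ps 17) (labD7 ends o a₁ a₂ a₃ b ps 18) := by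
    intro p hp5 hp
    by_cases hlt : labD7 ends o a₁ a₂ a₃ b ps p < 5
    · exact Or.inl hlt
    right
    rw [hdeg p]
    obtain ⟨f, hf, hpf⟩ := hmem p hp5 hp
    have hne : ∀ q, q < 5 → pt o a₁ a₂ a₃ b (xsOf7 ps) p ≠ pt o a₁ a₂ a₃ b (xsOf7 ps) q := by
      intro q hq h
      have := (heq p q).mpr h
      have := hle q
      omega
    exact hred.typedDeg_unmarked (hne 2 (by omega)) (hne 0 (by omega)) (hne 1 (by omega))
      (hne 4 (by omega)) (hne 3 (by omega)) hf hpf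
  have ho : labD7 ends o a₁ a₂ a₃ b ps 3 = 2 ∨ edeg7 2 (labD7 ends o a₁ a₂ a₃ b ps 5) (labD7 ends o a₁ a₂ a₃ b ps 6) (labD7 ends o a₁ a₂ a₃ b ps 7) (labD7 ends o a₁ a₂ a₃ b ps 8) (labD7 ends o a₁ a₂ a₃ b ps 9) (labD7 ends o a₁ a₂ a₃ b ps 10) (labD7 ends o a₁ a₂ a₃ b ps 11) (labD7 ends o a₁ a₂ a₃ b ps 12) (labD7 ends o a₁ a₂ a₃ b ps 13) (labD7 ends o a₁ a₂ a₃ b ps 14) (labD7 ends o a₁ a₂ a₃ b ps 15) (labD7 ends o a₁ a₂ a₃ b ps 16) (labD7 ends o a₁ a₂ a₃ b ps 17) (labD7 ends o a₁ a₂ a₃ b ps 18) ≠ 1 := by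
    by_cases h3 : labD7 ends o a₁ a₂ a₃ b ps 3 = 2
    · exact Or.inl h3
    right
    have hob : o ≠ b := by
      intro h
      apply h3
      rw [← hmk.2.1]
      exact (heq 3 2).mpr h.symm
    rw [← hmk.2.1, hdeg 2]
    have p2 : pt o a₁ a₂ a₃ b (xsOf7 ps) 2 = o := rfl
    rw [p2]
    intro h1
    obtain ⟨f, hf, hof⟩ := exists_edge_of_typedDeg_ne_zero7 ends (by rw [h1]; exact one_ne_zero)
    have := hred.typedDeg_o ho1 ho2 ho3 hob hf hof
    omega
  have hb : (labD7 ends o a₁ a₂ a₃ b ps 3 ≠ 3 ∨ labD7 ends o a₁ a₂ a₃ b ps 4 ≠ 4) ∨ edeg7 3 (labD7 ends o a₁ a₂ a₃ b ps 5) (labD7 ends o a₁ a₂ a₃ b ps 6) (labD7 ends o a₁ a₂ a₃ b ps 7) (labD7 ends o a₁ a₂ a₃ b ps 8) (labD7 ends o a₁ a₂ a₃ b ps 9) (labD7 ends o a₁ a₂ a₃ b ps 10) (labD7 ends o a₁ a₂ a₃ b ps 11) (labD7 ends o a₁ a₂ a₃ b ps 12) (labD7 ends o a₁ a₂ a₃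 b ps 13) (labD7 ends o a₁ a₂ a₃ b ps 14) (labD7 ends o a₁ a₂ a₃ b ps 15) (labD7 ends o a₁ a₂ a₃ b ps 16) (labD7 ends o a₁ a₂ a₃ b ps 17) (labD7 ends o a₁ a₂ a₃ b ps 18) ≠ 1 := by
    by_cases h34 : labD7 ends o a₁ a₂ a₃ b ps 3 = 3 ∧ labD7 ends o a₁ a₂ a₃ b ps 4 = 4
    swap
    · left
      by_contra hc
      push Not at hc
      exact h34 hc
    right
    have hbo : b ≠ o := by
      intro h
      have := (heq 3 2).mpr h
      omega
    have hb3 : b ≠ a₃ := by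
      intro h
      have := (heq 3 4).mpr h
      omega
    rw [← h34.1, hdeg 3]
    have p3 : pt o a₁ a₂ a₃ b (xsOf7 ps) 3 = b := rfl
    rw [p3]
    intro h1
    obtain ⟨f, hf, hbf⟩ := exists_edge_of_typedDeg_ne_zero7 ends (by rw [h1]; exact one_ne_zero)
    have := hred.typedDeg_b hbo hb1 hb2 hb3 hf hbf
    omega
  unfold degOK7
  simp only [Bool.and_eq_true, decide_eq_true_eq]
  exact ⟨⟨⟨hunm 5 (by omega) (by omega),
    hunm 6 (by omega) (by omega),
    hunm 7 (by omega) (by omega),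
    hunm 8 (by omega) (by omega),
    hunm 9 (by omega) (by omega),
    hunm 10 (by omega) (by omega),
    hunm 11 (by omega) (by omega),
    hunm 12 (by omega) (by omega),
    hunm 13 (by omega) (by omega),
    hunm 14 (by omega) (by omega),
    hunm 15 (by omega) (by omega),
    hunm 16 (by omega) (by omega),
    hunm 17 (by omega) (by omega),
    hunm 18 (by omega) (by omega)⟩, ho⟩, hb⟩


omit [Fintype E] in
/-- **The mark-degree guard holds when the marks `a₁, a₂, o, b` carry typed edges.** -/
lemma labD7_markdeg (hm : MarksDistinct o a₁ a₂ a₃ b) (e1 e2 e3 e4 e5 e6 e7 : E) (h12 : e1 ≠ e2) (h13 : e1 ≠ e3) (h14 : e1 ≠ e4) (h15 : e1 ≠ e5) (h16 : e1 ≠ e6) (h17 : e1 ≠ e7) (h23 : e2 ≠ e3) (h24 : e2 ≠ e4) (h25 : e2 ≠ e5) (h26 : e2 ≠ e6) (h27 : e2 ≠ e7) (h34 : e3 ≠ e4) (h35 : e3 ≠ e5) (h36 : e3 ≠ e6) (h37 : e3 ≠ e7) (h45 : e4 ≠ e5) (h46 : e4 ≠ e6) (h47 : e4 ≠ e7) (h56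 : e5 ≠ e6) (h57 : e5 ≠ e7) (h67 : e6 ≠ e7) (hends1 : ends e1 = s((ps 0).1, (ps 0).2)) (hends2 : ends e2 = s((ps 1).1, (ps 1).2)) (hends3 : ends e3 = s((ps 2).1, (ps 2).2)) (hends4 : ends e4 = s((ps 3).1, (ps 3).2)) (hends5 : ends e5 = s((ps 4).1, (ps 4).2)) (hends6 : ends e6 = s((ps 5).1, (ps 5).2)) (hends7 : ends e7 = s((ps 6).1, (ps 6).2))
    (hd1 : ∃ f ∈ ({e1, e2, e3, e4, e5, e6, e7} : Finset E), a₁ ∈ ends f) (hd2 : ∃ f ∈ ({e1, e2, e3, e4, e5, e6, e7} : Finset E), a₂ ∈ ends f)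
    (hdo : ∃ f ∈ ({e1, e2, e3, e4, e5, e6, e7} : Finset E), o ∈ ends f) (hdb : ∃ f ∈ ({e1, e2, e3, e4, e5, e6, e7} : Finset E), b ∈ ends f) :
    markDegOK7 (labD7 ends o a₁ a₂ a₃ b ps 3) (labD7 ends o a₁ a₂ a₃ b ps 5) (labD7 ends o a₁ a₂ a₃ b ps 6) (labD7 ends o a₁ a₂ a₃ b ps 7) (labD7 ends o a₁ a₂ a₃ b ps 8) (labD7 ends o a₁ a₂ a₃ b ps 9) (labD7 ends o a₁ a₂ a₃ b ps 10) (labD7 ends o a₁ a₂ a₃ b ps 11) (labD7 ends o a₁ a₂ a₃ b ps 12) (labD7 ends o a₁ a₂ a₃ b ps 13) (labD7 ends o a₁ a₂ a₃ b ps 14) (labD7 ends o a₁ a₂ a₃ b ps 15) (labD7 ends o a₁ a₂ a₃ b ps 16) (labD7 ends o a₁ a₂ a₃ b ps 17) (labD7 ends o a₁ a₂ a₃ b ps 18) = true := by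
  have hdeg := edeg7_eq ends o a₁ a₂ a₃ b ps e1 e2 e3 e4 e5 e6 e7 h12 h13 h14 h15 h16 h17 h23 h24 h25 h26 h27 h34 h35 h36 h37 h45 h46 h47 h56 h57 h67 hends1 hends2 hends3 hends4 hends5 hends6 hends7
  have hmk := labD7_marks ends o a₁ a₂ a₃ b ps hm
  have hpos : ∀ v : V, (∃ f ∈ ({e1, e2, e3, e4, e5, e6, e7} : Finset E), v ∈ ends f) → 1 ≤ typedDeg ends {e1, e2, e3, e4, e5, e6, e7} v := by
    rintro v ⟨f, hf, hv⟩
    exact Finset.card_pos.mpr ⟨f, Finset.mem_filter.mpr ⟨hf, hv⟩⟩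
  have h0 := hdeg 0
  rw [labD7_zero] at h0
  have h1 := hdeg 1
  rw [hmk.1] at h1
  have h2 := hdeg 2
  rw [hmk.2.1] at h2
  have h3 := hdeg 3
  unfold markDegOK7
  simp only [Bool.and_eq_true, decide_eq_true_eq]
  exact ⟨⟨⟨by rw [h0]; exact hpos _ hd1, by rw [h1]; exact hpos _ hd2⟩, by rw [h2]; exact hpos _ hdo⟩, by rw [h3]; exact hpos _ hdb⟩

/-- **Seven typed edges of a reduced instance IN THE DOMAIN OF RECORD**, modulo the finite statement `allOk7 okQ7Dom = true`: for seven distinct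
typed edges forming a reduced typed graph (marks distinct up to `b = a₃` / `o = b`), the typed count of
`K₃` in the all-closed configuration is nonnegative — the ends are re-ordered and re-oriented to the
sorted member of their orbit (`exists_sorted7`) and the sorted core applies. -/
theorem typedCount_sept_K3_nonneg_dom (hall : allOk7 okQ7Dom = true) (hm : MarksDistinct o a₁ a₂ a₃ b)
    (e : Fin 7 → E) (hinj : Function.Injective e)
    (hred : Reduced ends o a₁ a₂ a₃ b (Finset.univ.image e)) (τ : E → ℕ)
    (hτ : ∀ i, τ (e i) = 1 ∨ τ (e i) = 2)
    (hcon : Conn ends (TypedRed.typedConfig (Finset.univ.image e)) a₁ a₂)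
    (hmild : ¬ RootBridge.MildInst ends o a₁ a₂ a₃ b (Finset.univ.image e) (fun _ => false))
    (hd1 : ∃ f ∈ Finset.univ.image e, a₁ ∈ ends f) (hd2 : ∃ f ∈ Finset.univ.image e, a₂ ∈ ends f)
    (hdo : ∃ f ∈ Finset.univ.image e, o ∈ ends f) (hdb : ∃ f ∈ Finset.univ.image e, b ∈ ends f) :
    0 ≤ typedCount (Finset.univ.image e) (fun _ => false) τ
      (K3 ends o a₁ a₂ a₃ b : Config E → Config E → Config E → R) := by
  have hex : ∀ i : Fin 7, ∃ p : V × V, ends (e i) = s(p.1, p.2) := fun i => by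
    obtain ⟨⟨u, w⟩, h⟩ := Quot.exists_rep (ends (e i))
    exact ⟨(u, w), h.symm⟩
  choose ps hps using hex
  obtain ⟨σ, fl, hsort⟩ := exists_sorted7 ends o a₁ a₂ a₃ b (fun _ => false) ps
  have hF : Finset.univ.image e = ({e (σ 0), e (σ 1), e (σ 2), e (σ 3), e (σ 4), e (σ 5), e (σ 6)} : Finset E) := by
    rw [← Finset.image_univ_of_surjective σ.surjective, Finset.image_image]
    ext x
    simp only [Finset.mem_image, Finset.mem_univ, true_and, Finset.mem_insert, Finset.mem_singleton,
      Function.comp]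
    constructor
    · rintro ⟨i, rfl⟩
      fin_cases i <;> simp
    · rintro (rfl | rfl | rfl | rfl | rfl | rfl | rfl) <;> exact ⟨_, rfl⟩
  have hends' : ∀ i, ends (e (σ i)) = s((act7 σ fl ps i).1, (act7 σ fl ps i).2) := by
    intro i
    simp only [act7]
    split_ifs
    · rw [hps (σ i), Sym2.eq_swap]
    · exact hps (σ i)
  have hne : ∀ i j : Fin 7, i ≠ j → e (σ i) ≠ e (σ j) := fun i j hij h =>
    hij (σ.injective (hinj h))
  rw [hF] at hred hcon hmild hd1 hd2 hdo hdb ⊢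
  have hmem : ∀ i : Fin 7, e (σ i) ∈ ({e (σ 0), e (σ 1), e (σ 2), e (σ 3), e (σ 4), e (σ 5), e (σ 6)} : Finset E) := by
    intro i
    fin_cases i <;> simp
  have hred' := hred
  refine typedCount_sept_core_dom ends o a₁ a₂ a₃ b hall (e (σ 0)) (e (σ 1)) (e (σ 2)) (e (σ 3)) (e (σ 4)) (e (σ 5)) (e (σ 6))
    (hne 0 1 (by decide)) (hne 0 2 (by decide)) (hne 0 3 (by decide)) (hne 0 4 (by decide)) (hne 0 5 (by decide)) (hne 0 6 (by decide)) (hne 1 2 (by decide)) (hne 1 3 (by decide)) (hne 1 4 (by decide)) (hne 1 5 (by decide)) (hne 1 6 (by decide)) (hne 2 3 (by decide)) (hne 2 4 (by decide)) (hne 2 5 (by decide)) (hne 2 6 (by decide)) (hne 3 4 (by decide)) (hne 3 5 (by decide)) (hne 3 6 (by decide)) (hne 4 5 (by decide)) (hne 4 6 (by decide)) (hne 5 6 (by decide)) τ ?_ (act7 σ fl ps)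
    (hends' 0) (hends' 1) (hends' 2) (hends' 3) (hends' 4) (hends' 5) (hends' 6) hsort
    (labD7_marks ends o a₁ a₂ a₃ b (act7 σ fl ps) hm)
    (labD7_loop ends o a₁ a₂ a₃ b (act7 σ fl ps) hred' (hmem 0) (hends' 0) rfl rfl) (labD7_loop ends o a₁ a₂ a₃ b (act7 σ fl ps) hred' (hmem 1) (hends' 1) rfl rfl) (labD7_loop ends o a₁ a₂ a₃ b (act7 σ fl ps) hred' (hmem 2) (hends' 2) rfl rfl) (labD7_loop ends o a₁ a₂ a₃ b (act7 σ fl ps) hred' (hmem 3) (hends' 3) rfl rfl) (labD7_loop ends o a₁ a₂ a₃ b (act7 σ fl ps) hred' (hmem 4) (hends' 4) rfl rfl) (labD7_loop ends o a₁ a₂ a₃ b (act7 σ fl ps) hred' (hmem 5) (hends' 5) rfl rfl) (labD7_loop ends o a₁ a₂ a₃ b (act7 σ fl ps) hred' (hmem 6) (hends' 6) rfl rfl)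
    (labD7_par ends o a₁ a₂ a₃ b (act7 σ fl ps) hred' (hmem 0) (hmem 1) (hne 0 1 (by decide)) (hends' 0) (hends' 1) rfl rfl rfl rfl) (labD7_par ends o a₁ a₂ a₃ b (act7 σ fl ps) hred' (hmem 1) (hmem 2) (hne 1 2 (by decide)) (hends' 1) (hends' 2) rfl rfl rfl rfl) (labD7_par ends o a₁ a₂ a₃ b (act7 σ fl ps) hred' (hmem 2) (hmem 3) (hne 2 3 (by decide)) (hends' 2) (hends' 3) rfl rfl rfl rfl) (labD7_par ends o a₁ a₂ a₃ b (act7 σ fl ps) hred' (hmem 3) (hmem 4) (hne 3 4 (by decide)) (hends' 3) (hends' 4) rfl rfl rfl rfl) (labD7_par ends o a₁ a₂ a₃ b (act7 σ fl ps) hred' (hmem 4) (hmem 5) (hne 4 5 (by decide)) (hends' 4) (hends' 5) rfl rfl rfl rfl) (labD7_par ends o a₁ a₂ a₃ b (act7 σ fl ps) hred' (hmem 5) (hmem 6) (hne 5 6 (by decide)) (hends' 5) (hends' 6) rfl rfl rfl rfl)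
    (labD7_root ends o a₁ a₂ a₃ b (act7 σ fl ps) hm hred' (hmem 0) (hends' 0) rfl rfl) (labD7_root ends o a₁ a₂ a₃ b (act7 σ fl ps) hm hred' (hmem 1) (hends' 1) rfl rfl) (labD7_root ends o a₁ a₂ a₃ b (act7 σ fl ps) hm hred' (hmem 2) (hends' 2) rfl rfl) (labD7_root ends o a₁ a₂ a₃ b (act7 σ fl ps) hm hred' (hmem 3) (hends' 3) rfl rfl) (labD7_root ends o a₁ a₂ a₃ b (act7 σ fl ps) hm hred' (hmem 4) (hends' 4) rfl rfl) (labD7_root ends o a₁ a₂ a₃ b (act7 σ fl ps) hm hred' (hmem 5) (hends' 5) rfl rfl) (labD7_root ends o a₁ a₂ a₃ b (act7 σ fl ps) hm hred' (hmem 6) (hends' 6) rfl rfl)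
    (labD7_deg ends o a₁ a₂ a₃ b (act7 σ fl ps) hm (e (σ 0)) (e (σ 1)) (e (σ 2)) (e (σ 3)) (e (σ 4)) (e (σ 5)) (e (σ 6)) hred'
      (hne 0 1 (by decide)) (hne 0 2 (by decide)) (hne 0 3 (by decide)) (hne 0 4 (by decide)) (hne 0 5 (by decide)) (hne 0 6 (by decide)) (hne 1 2 (by decide)) (hne 1 3 (by decide)) (hne 1 4 (by decide)) (hne 1 5 (by decide)) (hne 1 6 (by decide)) (hne 2 3 (by decide)) (hne 2 4 (by decide)) (hne 2 5 (by decide)) (hne 2 6 (by decide)) (hne 3 4 (by decide)) (hne 3 5 (by decide)) (hne 3 6 (by decide)) (hne 4 5 (by decide)) (hne 4 6 (by decide)) (hne 5 6 (by decide)) (hends' 0) (hends' 1) (hends' 2) (hends' 3) (hends' 4) (hends' 5) (hends' 6))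
    (labD7_markdeg ends o a₁ a₂ a₃ b (act7 σ fl ps) hm (e (σ 0)) (e (σ 1)) (e (σ 2)) (e (σ 3)) (e (σ 4)) (e (σ 5)) (e (σ 6)) (hne 0 1 (by decide)) (hne 0 2 (by decide)) (hne 0 3 (by decide)) (hne 0 4 (by decide)) (hne 0 5 (by decide)) (hne 0 6 (by decide)) (hne 1 2 (by decide)) (hne 1 3 (by decide)) (hne 1 4 (by decide)) (hne 1 5 (by decide)) (hne 1 6 (by decide)) (hne 2 3 (by decide)) (hne 2 4 (by decide)) (hne 2 5 (by decide)) (hne 2 6 (by decide)) (hne 3 4 (by decide)) (hne 3 5 (by decide)) (hne 3 6 (by decide)) (hne 4 5 (by decide)) (hne 4 6 (by decide)) (hne 5 6 (by decide)) (hends' 0) (hends' 1) (hends' 2) (hends' 3) (hends' 4) (hends' 5) (hends' 6) hd1 hd2 hdo hdb)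
    (by rw [← typedConfig_seven]; exact hcon)
    (exists_bad_of_not_mild ends o a₁ a₂ a₃ b (e (σ 0)) (e (σ 1)) (e (σ 2)) (e (σ 3)) (e (σ 4)) (e (σ 5)) (e (σ 6)) (hne 0 1 (by decide)) (hne 0 2 (by decide)) (hne 0 3 (by decide)) (hne 0 4 (by decide)) (hne 0 5 (by decide)) (hne 0 6 (by decide)) (hne 1 2 (by decide)) (hne 1 3 (by decide)) (hne 1 4 (by decide)) (hne 1 5 (by decide)) (hne 1 6 (by decide)) (hne 2 3 (by decide)) (hne 2 4 (by decide)) (hne 2 5 (by decide)) (hne 2 6 (by decide)) (hne 3 4 (by decide)) (hne 3 5 (by decide)) (hne 3 6 (by decide)) (hne 4 5 (by decide)) (hne 4 6 (by decide)) (hne 5 6 (by decide)) hmild)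
  intro e' he'
  simp only [Finset.mem_insert, Finset.mem_singleton] at he'
  rcases he' with rfl | rfl | rfl | rfl | rfl | rfl | rfl <;> exact hτ _

/-- **ROW 2′TRI ON THE DOMAIN-RESTRICTED REDUCED CLASS WITH SEVEN TYPED EDGES**, modulo the finite statement: (marks `a₁, a₂, o, b` of typed degree `≥ 1`, roots connected in the typed graph, not mild) every
reduced instance (`z ≡ false`, marks distinct up to `b = a₃` / `o = b`) with exactly seven typed edges
has a nonnegative typed base. -/
theorem typedCount_nonneg_of_dom_card_seven (hall : allOk7 okQ7Dom = true) (hm : MarksDistinct o a₁ a₂ a₃ b)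
    (F : Finset E) (hF : F.card = 7) (hred : Reduced ends o a₁ a₂ a₃ b F) (τ : E → ℕ)
    (hτ : ∀ e ∈ F, τ e = 1 ∨ τ e = 2)
    (hcon : Conn ends (TypedRed.typedConfig F) a₁ a₂)
    (hmild : ¬ RootBridge.MildInst ends o a₁ a₂ a₃ b F (fun _ => false))
    (hd1 : ∃ f ∈ F, a₁ ∈ ends f) (hd2 : ∃ f ∈ F, a₂ ∈ ends f) (hdo : ∃ f ∈ F, o ∈ ends f)
    (hdb : ∃ f ∈ F, b ∈ ends f) :
    0 ≤ typedCount F (fun _ => false) τ (K3 ends o a₁ a₂ a₃ b : Config E → Config E → Config E → R) := by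
  let eq : F ≃ Fin 7 := (Finset.equivFin F).trans (finCongr hF)
  let e : Fin 7 → E := fun i => (eq.symm i).1
  have hinj : Function.Injective e := fun i j h => eq.symm.injective (Subtype.ext h)
  have hFe : Finset.univ.image e = F := by
    ext x
    simp only [Finset.mem_image, Finset.mem_univ, true_and]
    constructor
    · rintro ⟨i, rfl⟩
      exact (eq.symm i).2
    · intro hx
      exact ⟨eq ⟨x, hx⟩, by simp [e]⟩
  rw [← hFe] at hred hcon hmild hd1 hd2 hdo hdb ⊢
  exact typedCount_sept_K3_nonneg_dom ends o a₁ a₂ a₃ b hall hm e hinj hred τ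
    (fun i => hτ (e i) (by rw [← hFe]; exact Finset.mem_image_of_mem e (Finset.mem_univ i))) hcon hmild hd1 hd2 hdo hdb

end Bridge7D

end TwoTyped

end CovForm

end Summit.Ventures.PercRepro2
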